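import Literature.NumberTheory.EllipticCurves.ZpExtensionShapiroToEisensteinKolyvaginSystemProofs
import Literature.NumberTheory.EllipticCurves.ZpExtensionEisensteinBadPlacesLocalTorsionProofs
import Literature.NumberTheory.EllipticCurves.ZpExtensionShapiroDualityDatum
import Literature.NumberTheory.EllipticCurves.ZpExtensionEisensteinConjugationDatumProofs
import Literature.NumberTheory.EllipticCurves.ZpExtensionEisensteinH1Limit
import Summits.BirchSwinnertonDyer.BirchSwinnertonDyer.Theorems.PrintX9MuPartStubAKSLinkOfPrint
import Summits.BirchSwinnertonDyer.BirchSwinnertonDyer.Theorems.UniversalToricDescentControlImageNonvanishing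
import Summits.BirchSwinnertonDyer.BirchSwinnertonDyer.Theorems.UniversalToricDescentTowerNoPTorsion
import HarnessLib

/-!
# Howard's Eisenstein-level Kolyvagin systems WITH THE LINK from ONE Λ-adic source Kolyvagin system — frame-free (any conductor,
# any reduction type at `p`), non-vanishing from `z ≠ 0` alone

Summits-side helper toward crux r205 stmt-BirchSwinnertonDyer-24737 `…Theses.UniversalToricDescent.TwinAlgMuZeroAtThree`, line
`beta-road` (LEAD lineage `bsd-wall-utd-p1`, g27; `--supports`).  ROUTE-INDEPENDENT; THEOREMS ONLY (no definition, no named fact, no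
instance, no `sorry`).

WHY.  The registered research stub `stub_ksTwin` (v14) asks, for every large `m`, for a Kolyvagin system on the twin's levels-tame
EISENSTEIN setting at `q_m = T^m + 3` linked to the control image of the `Λ`-adic Heegner class.  Cell x9 derives exactly this shape
on the print frame from ONE Λ-ADIC Kolyvagin system (CGLS Thm. 4.1.1 = F-411, over lit's source setting `S_Λ`) by pushforward along
THE `Hom` `S_Λ → (T_𝔮, F_𝔮, 𝓛_E)` (`exists_eisensteinKolyvaginSystem_one_eq_proj`, `exists_ksLink_of_thm411`).  Those two theorems are
welded to `Thm413Hypotheses` (good ordinary, `p ∤ 2N`) only through the fields `level/topGenerator/noPTorsion/anticyclotomic/heegner`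
and through the fact F-411 itself; this file re-runs them with the Λ-adic Kolyvagin system as a HYPOTHESIS and the frame fields as
plain binders, so that the twin's research residue can be registered in its print shape — «a Kolyvagin system `κ^{Hg} ∈ KS(𝐓, 𝓕_Λ, 𝓛_E)`
with `κ₁ = Φ′(𝐳_∞)`» (Howard Thm. 2.3.1 / CGLS Thm. 4.1.1 + Rem. 4.1.4, at a MULTIPLICATIVE prime) — skeleton v15.
* `exists_eisensteinKolyvaginSystem_one_eq_proj_of_source` (§1), `exists_ksLink_of_source` (§2): generic `p`, `N`, `W`.
* (sequel `UniversalToricDescentTwinKsTwinOfLambdaAdicKS`: in the binders of crux 24737 at `p = 3`, the registered signature of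
  `stub_ksTwin` VERBATIM from the Λ-adic source hypothesis — the body of v15's `stub_ksTwinLambda`.)
No summit statement is proved; BSD is not proved by any of this.

References: [Howard2004HeegnerKolyvagin] Thm. 2.3.1, Rem. 1.2.4, §1.6, Lemma 2.2.9, proof of Thm. 2.2.10 (arXiv:1202.6340 p0017 L78–92);
[CastellaGrossiLeeSkinner2022] Thm. 4.1.1, Rem. 4.1.4, §3.2, §3.4.
-/

set_option linter.dupNamespace false
set_option autoImplicit false

noncomputable section

open scoped TensorProduct Topology Classical ContRepresentation NumberField
open Field CategoryTheory IsLocalRing IsDedekindDomain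

namespace WeierstrassCurve

open Literature.NumberTheory.EllipticCurves Literature.NumberTheory.GaloisRepresentations
open Literature.NumberTheory.GaloisRepresentations.DiscreteGaloisModule
open Literature.NumberTheory.GaloisCohomology.Howard2004
open Literature.NumberTheory.EllipticCurves.ZpExtension
open Literature.NumberTheory.EllipticCurves.CastellaGrossiLeeSkinner2022
open Summit.BirchSwinnertonDyer.BirchSwinnertonDyer.Theorems

variable {K : Type} [Field K] [NumberField K] (W : WeierstrassCurve ℚ) [W.IsElliptic] {p : ℕ} [hp : Fact p.Prime]
  (κ : ZpExtension K p) {m : ℕ} (hm : 1 ≤ m)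
  (π : ∀ v : HeightOneSpectrum (𝓞 K), TamePin v)
  {N : ℕ} [NeZero N] {γ : absoluteGaloisGroup K}

/-! ## §1 The pushforward from a Λ-adic source Kolyvagin system -/

set_option synthInstance.maxHeartbeats 80000 in
/-- **`κ′ ∈ KS(T_𝔮, F_𝔮, 𝓛_E)` with `κ′_k = proj_{k+1} (f_m z)` from a Λ-ADIC SOURCE Kolyvagin system** — x9-p2's
`exists_eisensteinKolyvaginSystem_one_eq_proj` with the CGLS fact (F-411) and its frame `Thm413Hypotheses` REPLACED by the HYPOTHESIS
`hsrc`: a Kolyvagin system on lit's `Λ`-adic source setting `S_Λ` (`shapiroSettingTame` at the twist `Ψ⁻¹`, `S = {v ∣ pN}`, `𝓛 = 𝓛_E`,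
levels guard, the given slots `π, cd, πbar, Dsrc`) whose bottom class is `Φ′(z)` (`toShapiroSuccLimitH1`).  Conclusion VERBATIM x9's:
restricted to an admissible cofinal sub-tower (`exists_idxSeq_adm`) and pushed along THE `Hom` (`exists_kolyvaginSystem_ofHom_one_eq`)
into D1's `eisensteinDVRSettingLevelsTame` at `m`, the bottom classes computed by the LINK (`shapiroToEisensteinHom_fH1_toShapiroSuccLimitH1`).
Frame-free: ANY `E/ℚ` with conductor `N` (`hN`), any `K`, `κ`, `γ` topological generator, `E(K)[p] = 0` — in particular a prime `p` of
MULTIPLICATIVE reduction.  [cite: Howard2004HeegnerKolyvagin, proof of Thm. 2.2.10 (arXiv:1202.6340 p0017 L78–81), Rem. 1.2.4, §1.6]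
[cite: CastellaGrossiLeeSkinner2022, §3.2 (𝓛_E), §3.4, Rem. 4.1.4] -/
theorem exists_eisensteinKolyvaginSystem_one_eq_proj_of_source
    (hN : N = W.conductorNorm ℤ) (hγ : κ.IsTopGenerator γ)
    (hE : ∀ P : (W.baseChange K).toAffine.Point, p • P = 0 → P = 0) (jbar : AlgebraicClosure K →+* ℂ)
    (Dsel : (W.baseChange K).LambdaAdicSelmerData κ γ) (z : Dsel.S)
    (cd : ConjugationDatum K)
    (πbar : letI := W.shapiroResidueModule K p
      ∀ j, W.ShapiroLevel K p j →ₗ[IwasawaAlgebra p ⧸ shapiroIdeal p (j + 1)] geomTorsion (W.baseChange K) (p : ℤ))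
    (Dsrc : ∀ j, DualityDatum p cd ((W.shapiroTower K p (κ.unitTwist (-1))).ρ j) (IwasawaAlgebra p ⧸ shapiroIdeal p (j + 1)))
    (hsrc : letI := W.shapiroResidueModule K p
      ∃ κsrc : (W.shapiroSettingTame (κ.unitTwist (-1)) π
        (fun n v ↦ n ∈ levels (CastellaGrossiLeeSkinner2022.heegnerKolyvaginPrimes W (κ.unitTwist (-1))
          (CastellaGrossiLeeSkinner2022.placesDividing K (p * N) CastellaGrossiLeeSkinner2022.mul_level_ne_zero)) ∧ v ∈ n)
        (W.shapiroTameHyp_of_mem_levels (κ.unitTwist (-1))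
          (CastellaGrossiLeeSkinner2022.placesDividing K (p * N) CastellaGrossiLeeSkinner2022.mul_level_ne_zero)
          (fun _ hv ↦ CastellaGrossiLeeSkinner2022.mem_placesDividing_of_dvd CastellaGrossiLeeSkinner2022.mul_level_ne_zero
            (dvd_mul_right p N) hv)
          (fun _ hv _ ↦ CastellaGrossiLeeSkinner2022.hasGoodReductionAt_of_not_mem_placesDividing W hN
            CastellaGrossiLeeSkinner2022.mul_level_ne_zero hv)
          (CastellaGrossiLeeSkinner2022.heegnerKolyvaginPrimes W (κ.unitTwist (-1))
            (CastellaGrossiLeeSkinner2022.placesDividing K (p * N) CastellaGrossiLeeSkinner2022.mul_level_ne_zero))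
          (CastellaGrossiLeeSkinner2022.heegnerKolyvaginPrimes_subset_degreeTwoPrimes W (κ.unitTwist (-1)) _)
          (fun _ hv ↦ CastellaGrossiLeeSkinner2022.not_mem_of_mem_heegnerKolyvaginPrimes W (κ.unitTwist (-1)) _ hv))
        (CastellaGrossiLeeSkinner2022.placesDividing K (p * N) CastellaGrossiLeeSkinner2022.mul_level_ne_zero)
        (fun _ hv ↦ CastellaGrossiLeeSkinner2022.mem_placesDividing_of_dvd CastellaGrossiLeeSkinner2022.mul_level_ne_zero
          (dvd_mul_right p N) hv)
        (fun _ hv _ ↦ CastellaGrossiLeeSkinner2022.hasGoodReductionAt_of_not_mem_placesDividing W hN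
          CastellaGrossiLeeSkinner2022.mul_level_ne_zero hv)
        (CastellaGrossiLeeSkinner2022.heegnerKolyvaginPrimes W (κ.unitTwist (-1))
          (CastellaGrossiLeeSkinner2022.placesDividing K (p * N) CastellaGrossiLeeSkinner2022.mul_level_ne_zero))
        (CastellaGrossiLeeSkinner2022.heegnerKolyvaginPrimes_subset_degreeTwoPrimes W (κ.unitTwist (-1)) _)
        (fun _ hv ↦ CastellaGrossiLeeSkinner2022.not_mem_of_mem_heegnerKolyvaginPrimes W (κ.unitTwist (-1)) _ hv)
        jbar cd πbar Dsrc).KolyvaginSystem,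
        κsrc.one = (W.toShapiroSuccLimitH1 Dsel hγ hE z).1)
    (cdt : ConjugationDatum K)
    (Dt : letI := IwasawaAlgebra.isLocalRing_quotient_X_pow_add_C p hm
      ∀ k, DualityDatum p cdt ((W.eisensteinTower (κ.unitTwist (-1)) hm).ρ k) (IwasawaAlgebra.EisensteinCoeff p m (k + 1)))
    (I : ZpExtension.EisensteinH1Data (κ.unitTwist (-1)) (fun k ↦ (W.baseChange K).torsionGaloisModule ((p : ℤ) ^ k)) (fun j ↦ (W.baseChange K).torsionGaloisModuleReduce p j) hm)
    (hS : ∀ v ∈ (CastellaGrossiLeeSkinner2022.placesDividing K (p * N) CastellaGrossiLeeSkinner2022.mul_level_ne_zero),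
      ((p : ℕ) : 𝓞 K) ∉ v.asIdeal → ∃ c : ℕ, ∀ i, 1 ≤ i → ∀ x : galoisCohomology
        (((κ.unitTwist (-1)).eisensteinTwist ((W.baseChange K).torsionGaloisModule ((p : ℤ) ^ i)) hm i).toLocal (Sum.inr v)) 1,
        p ^ c • x = 0)
    (hy :
    letI := IwasawaAlgebra.isDomain_quotient_X_pow_add_C p hm
    letI := IwasawaAlgebra.isDiscreteValuationRing_quotient_X_pow_add_C p hm
    haveI := IwasawaAlgebra.EisensteinCoeff.isLocalRing_succ p hm
    letI := IwasawaAlgebra.EisensteinCoeff.algebraOfSpecSucc p m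
    haveI := W.isScalarTower_algebraOfSpecSucc (K := K) (p := p) (m := m)
    letI := W.residueModuleSucc (K := K) (p := p) hm
    letI := W.shapiroResidueModule K p
    (W.eisensteinDVRSettingLevelsTame (κ.unitTwist (-1)) hm π
      (CastellaGrossiLeeSkinner2022.placesDividing K (p * N) CastellaGrossiLeeSkinner2022.mul_level_ne_zero)
      (fun _ hv ↦ CastellaGrossiLeeSkinner2022.mem_placesDividing_of_dvd CastellaGrossiLeeSkinner2022.mul_level_ne_zero
      (dvd_mul_right p N) hv)
      (fun _ hv _ ↦ CastellaGrossiLeeSkinner2022.hasGoodReductionAt_of_not_mem_placesDividing W hN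
      CastellaGrossiLeeSkinner2022.mul_level_ne_zero hv)
      (CastellaGrossiLeeSkinner2022.heegnerKolyvaginPrimes W (κ.unitTwist (-1))
      (CastellaGrossiLeeSkinner2022.placesDividing K (p * N) CastellaGrossiLeeSkinner2022.mul_level_ne_zero))
      (W.heegnerKolyvaginPrimes_subset_degreeTwoPrimes_eisensteinTower (κ.unitTwist (-1)) hm (κ.unitTwist (-1))
      (CastellaGrossiLeeSkinner2022.placesDividing K (p * N) CastellaGrossiLeeSkinner2022.mul_level_ne_zero)
      (fun _ hv _ ↦ CastellaGrossiLeeSkinner2022.hasGoodReductionAt_of_not_mem_placesDividing W hN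
      CastellaGrossiLeeSkinner2022.mul_level_ne_zero hv))
      (fun _ hv ↦ CastellaGrossiLeeSkinner2022.not_mem_of_mem_heegnerKolyvaginPrimes W (κ.unitTwist (-1)) _ hv) jbar cdt Dt).SatisfiesH) :
    letI := IwasawaAlgebra.isDomain_quotient_X_pow_add_C p hm
    letI := IwasawaAlgebra.isDiscreteValuationRing_quotient_X_pow_add_C p hm
    haveI := IwasawaAlgebra.EisensteinCoeff.isLocalRing_succ p hm
    letI := IwasawaAlgebra.EisensteinCoeff.algebraOfSpecSucc p m
    haveI := W.isScalarTower_algebraOfSpecSucc (K := K) (p := p) (m := m)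
    letI := W.residueModuleSucc (K := K) (p := p) hm
    letI := W.shapiroResidueModule K p
    ∃ κKS : (W.eisensteinDVRSettingLevelsTame (κ.unitTwist (-1)) hm π
      (CastellaGrossiLeeSkinner2022.placesDividing K (p * N) CastellaGrossiLeeSkinner2022.mul_level_ne_zero)
      (fun _ hv ↦ CastellaGrossiLeeSkinner2022.mem_placesDividing_of_dvd CastellaGrossiLeeSkinner2022.mul_level_ne_zero
      (dvd_mul_right p N) hv)
      (fun _ hv _ ↦ CastellaGrossiLeeSkinner2022.hasGoodReductionAt_of_not_mem_placesDividing W hN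
      CastellaGrossiLeeSkinner2022.mul_level_ne_zero hv)
      (CastellaGrossiLeeSkinner2022.heegnerKolyvaginPrimes W (κ.unitTwist (-1))
      (CastellaGrossiLeeSkinner2022.placesDividing K (p * N) CastellaGrossiLeeSkinner2022.mul_level_ne_zero))
      (W.heegnerKolyvaginPrimes_subset_degreeTwoPrimes_eisensteinTower (κ.unitTwist (-1)) hm (κ.unitTwist (-1))
      (CastellaGrossiLeeSkinner2022.placesDividing K (p * N) CastellaGrossiLeeSkinner2022.mul_level_ne_zero)
      (fun _ hv _ ↦ CastellaGrossiLeeSkinner2022.hasGoodReductionAt_of_not_mem_placesDividing W hN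
      CastellaGrossiLeeSkinner2022.mul_level_ne_zero hv))
      (fun _ hv ↦ CastellaGrossiLeeSkinner2022.not_mem_of_mem_heegnerKolyvaginPrimes W (κ.unitTwist (-1)) _ hv) jbar cdt Dt).KolyvaginSystem,
      ∀ k, κKS.one k = I.proj (k + 1) (Dsel.toEisensteinH1Linear hm (fun j ↦ (W.baseChange K).torsionGaloisModuleReduce p j) (fun _ _ ↦ rfl) I
        hγ hE z) := by
  letI := IwasawaAlgebra.isDomain_quotient_X_pow_add_C p hm
  letI := IwasawaAlgebra.isDiscreteValuationRing_quotient_X_pow_add_C p hm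
  haveI := IwasawaAlgebra.EisensteinCoeff.isLocalRing_succ p hm
  letI := IwasawaAlgebra.EisensteinCoeff.algebraOfSpecSucc p m
  haveI := W.isScalarTower_algebraOfSpecSucc (K := K) (p := p) (m := m)
  letI := W.residueModuleSucc (K := K) (p := p) hm
  letI := W.shapiroResidueModule K p
  obtain ⟨s₀, d, -, hadm⟩ := exists_idxSeq_adm p (m := m) hm
  obtain ⟨κsrc, hone⟩ := hsrc
  obtain ⟨κKS, hKS⟩ := W.exists_kolyvaginSystem_ofHom_one_eq (κ.unitTwist (-1)) hm π (CastellaGrossiLeeSkinner2022.placesDividing K (p * N) CastellaGrossiLeeSkinner2022.mul_level_ne_zero)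
    (fun _ hv ↦ CastellaGrossiLeeSkinner2022.mem_placesDividing_of_dvd CastellaGrossiLeeSkinner2022.mul_level_ne_zero
      (dvd_mul_right p N) hv)
    (fun _ hv _ ↦ CastellaGrossiLeeSkinner2022.hasGoodReductionAt_of_not_mem_placesDividing W hN
      CastellaGrossiLeeSkinner2022.mul_level_ne_zero hv)
    (CastellaGrossiLeeSkinner2022.heegnerKolyvaginPrimes W (κ.unitTwist (-1))
      (CastellaGrossiLeeSkinner2022.placesDividing K (p * N) CastellaGrossiLeeSkinner2022.mul_level_ne_zero))
    (CastellaGrossiLeeSkinner2022.heegnerKolyvaginPrimes_subset_degreeTwoPrimes W (κ.unitTwist (-1)) _)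
    (W.heegnerKolyvaginPrimes_subset_degreeTwoPrimes_eisensteinTower (κ.unitTwist (-1)) hm (κ.unitTwist (-1))
      (CastellaGrossiLeeSkinner2022.placesDividing K (p * N) CastellaGrossiLeeSkinner2022.mul_level_ne_zero)
      (fun _ hv _ ↦ CastellaGrossiLeeSkinner2022.hasGoodReductionAt_of_not_mem_placesDividing W hN
      CastellaGrossiLeeSkinner2022.mul_level_ne_zero hv))
    (fun _ hv ↦ CastellaGrossiLeeSkinner2022.not_mem_of_mem_heegnerKolyvaginPrimes W (κ.unitTwist (-1)) _ hv) jbar cd πbar Dsrc cdt Dt s₀ d hadm hS κsrc hy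
  refine ⟨κKS, fun k ↦ (hKS k).trans ((congrArg _ (congrFun hone (idxSeq s₀ d k))).trans ?_)⟩
  exact W.shapiroToEisensteinHom_fH1_toShapiroSuccLimitH1 (κ := κ) (hm := hm) (π := π) (S := (CastellaGrossiLeeSkinner2022.placesDividing K (p * N) CastellaGrossiLeeSkinner2022.mul_level_ne_zero))
    (hpS := (fun _ hv ↦ CastellaGrossiLeeSkinner2022.mem_placesDividing_of_dvd CastellaGrossiLeeSkinner2022.mul_level_ne_zero
      (dvd_mul_right p N) hv))
    (hbad := (fun _ hv _ ↦ CastellaGrossiLeeSkinner2022.hasGoodReductionAt_of_not_mem_placesDividing W hN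
      CastellaGrossiLeeSkinner2022.mul_level_ne_zero hv))
    (L := (CastellaGrossiLeeSkinner2022.heegnerKolyvaginPrimes W (κ.unitTwist (-1))
      (CastellaGrossiLeeSkinner2022.placesDividing K (p * N) CastellaGrossiLeeSkinner2022.mul_level_ne_zero)))
    (hLS := (fun _ hv ↦ CastellaGrossiLeeSkinner2022.not_mem_of_mem_heegnerKolyvaginPrimes W (κ.unitTwist (-1)) _ hv)) (jbar := jbar) (cd := cd) (cdt := cdt) (s₀ := s₀) (d := d) (hadm := hadm)
    (Dsel := Dsel) (hγ := hγ) (hE := hE)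
    (hL' := (CastellaGrossiLeeSkinner2022.heegnerKolyvaginPrimes_subset_degreeTwoPrimes W (κ.unitTwist (-1)) _))
    (hLt' := (W.heegnerKolyvaginPrimes_subset_degreeTwoPrimes_eisensteinTower (κ.unitTwist (-1)) hm (κ.unitTwist (-1))
      (CastellaGrossiLeeSkinner2022.placesDividing K (p * N) CastellaGrossiLeeSkinner2022.mul_level_ne_zero)
      (fun _ hv _ ↦ CastellaGrossiLeeSkinner2022.hasGoodReductionAt_of_not_mem_placesDividing W hN
      CastellaGrossiLeeSkinner2022.mul_level_ne_zero hv)))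
    (πbar' := πbar) (D' := Dsrc) (Dt' := Dt) (hS' := hS) (I := I) (k := k) (z := z)


/-! ## §2 The link + non-vanishing for `m ≫ 0` -/

section Link

set_option synthInstance.maxHeartbeats 80000 in
/-- **The Eisenstein-level Kolyvagin systems WITH THE LINK, non-zero, for `m ≫ 0`, from a Λ-adic source Kolyvagin system** —
x9-p1's `exists_ksLink_of_thm411` with (F-411)/`Thm413Hypotheses` replaced by the ∀-slots source hypothesis `hsrc` (a Kolyvagin system
on `S_Λ` with bottom class `Φ′(z)`, for every choice of the presentation slots `π, cd, πbar, Dsrc` — cf. CGLS Thm. 4.1.1 / Rem. 4.1.4 and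
lit's `kolyvaginSystemCongr`) and with the non-vanishing `κ′.one ≠ 0` from `z ≠ 0` ALONE (g27's `…ControlImageNonvanishing`, no
`Module.Finite 𝔖`, no `𝔖/Λz` torsion).  `K` imaginary quadratic, `κ` anticyclotomic, Heegner for `N` (conductor, `hN`), `γ` a topological
generator, `E(K)[p] = 0`; conclusion VERBATIM x9's: for `m ≥ m₁`, every tame pins, every target `cd, Dd, hy`, a Kolyvagin system on
`eisensteinDVRSettingLevelsTame` at `S = {v ∣ pN}`, `𝓛 = 𝓛_E`, `t = (p ·)`, `I = eisensteinH1Limit`, with `κ′.one ≠ 0` and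
`κ′.one k = proj_{k+1} (f_m z)`.  [cite: Howard2004HeegnerKolyvagin, Rem. 1.2.4, §1.6, Lemma 2.2.9, proof of Thm. 2.2.10 (arXiv p. 17)]
[cite: CastellaGrossiLeeSkinner2022, Thm. 4.1.1, Rem. 4.1.4, §3.2, §3.4] -/
theorem exists_ksLink_of_source (hN : N = W.conductorNorm ℤ) (hK : IsImaginaryQuadratic K) (hκ : κ.IsAnticyclotomic)
    (hHeeg : SatisfiesHeegnerHypothesis N K) (hγ : κ.IsTopGenerator γ)
    (hE : ∀ P : (W.baseChange K).toAffine.Point, p • P = 0 → P = 0) (jbar : AlgebraicClosure K →+* ℂ)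
    (D : (W.baseChange K).LambdaAdicSelmerData κ γ) (z : D.S) (hz0 : z ≠ 0)
    (hsrc : ∀ (π : ∀ v : HeightOneSpectrum (𝓞 K), TamePin v) (cd : ConjugationDatum K)
      (πbar : letI := W.shapiroResidueModule K p
        ∀ j, W.ShapiroLevel K p j →ₗ[IwasawaAlgebra p ⧸ shapiroIdeal p (j + 1)] geomTorsion (W.baseChange K) (p : ℤ))
      (Dsrc : ∀ j, DualityDatum p cd ((W.shapiroTower K p (κ.unitTwist (-1))).ρ j) (IwasawaAlgebra p ⧸ shapiroIdeal p (j + 1))),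
      letI := W.shapiroResidueModule K p
      ∃ κsrc : (W.shapiroSettingTame (κ.unitTwist (-1)) π
        (fun n v ↦ n ∈ levels (CastellaGrossiLeeSkinner2022.heegnerKolyvaginPrimes W (κ.unitTwist (-1))
          (CastellaGrossiLeeSkinner2022.placesDividing K (p * N) CastellaGrossiLeeSkinner2022.mul_level_ne_zero)) ∧ v ∈ n)
        (W.shapiroTameHyp_of_mem_levels (κ.unitTwist (-1))
          (CastellaGrossiLeeSkinner2022.placesDividing K (p * N) CastellaGrossiLeeSkinner2022.mul_level_ne_zero)
          (fun _ hv ↦ CastellaGrossiLeeSkinner2022.mem_placesDividing_of_dvd CastellaGrossiLeeSkinner2022.mul_level_ne_zero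
            (dvd_mul_right p N) hv)
          (fun _ hv _ ↦ CastellaGrossiLeeSkinner2022.hasGoodReductionAt_of_not_mem_placesDividing W hN
            CastellaGrossiLeeSkinner2022.mul_level_ne_zero hv)
          (CastellaGrossiLeeSkinner2022.heegnerKolyvaginPrimes W (κ.unitTwist (-1))
            (CastellaGrossiLeeSkinner2022.placesDividing K (p * N) CastellaGrossiLeeSkinner2022.mul_level_ne_zero))
          (CastellaGrossiLeeSkinner2022.heegnerKolyvaginPrimes_subset_degreeTwoPrimes W (κ.unitTwist (-1)) _)
          (fun _ hv ↦ CastellaGrossiLeeSkinner2022.not_mem_of_mem_heegnerKolyvaginPrimes W (κ.unitTwist (-1)) _ hv))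
        (CastellaGrossiLeeSkinner2022.placesDividing K (p * N) CastellaGrossiLeeSkinner2022.mul_level_ne_zero)
        (fun _ hv ↦ CastellaGrossiLeeSkinner2022.mem_placesDividing_of_dvd CastellaGrossiLeeSkinner2022.mul_level_ne_zero
          (dvd_mul_right p N) hv)
        (fun _ hv _ ↦ CastellaGrossiLeeSkinner2022.hasGoodReductionAt_of_not_mem_placesDividing W hN
          CastellaGrossiLeeSkinner2022.mul_level_ne_zero hv)
        (CastellaGrossiLeeSkinner2022.heegnerKolyvaginPrimes W (κ.unitTwist (-1))
          (CastellaGrossiLeeSkinner2022.placesDividing K (p * N) CastellaGrossiLeeSkinner2022.mul_level_ne_zero))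
        (CastellaGrossiLeeSkinner2022.heegnerKolyvaginPrimes_subset_degreeTwoPrimes W (κ.unitTwist (-1)) _)
        (fun _ hv ↦ CastellaGrossiLeeSkinner2022.not_mem_of_mem_heegnerKolyvaginPrimes W (κ.unitTwist (-1)) _ hv)
        jbar cd πbar Dsrc).KolyvaginSystem,
        κsrc.one = (W.toShapiroSuccLimitH1 D hγ hE z).1) :
    ∃ m₁ : ℕ, ∀ (m : ℕ) (hm : 1 ≤ m), m₁ ≤ m →
      letI := IwasawaAlgebra.isDomain_quotient_X_pow_add_C p hm
      letI := IwasawaAlgebra.isDiscreteValuationRing_quotient_X_pow_add_C p hm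
      haveI := IwasawaAlgebra.EisensteinCoeff.isLocalRing_succ p hm
      letI := IwasawaAlgebra.EisensteinCoeff.algebraOfSpecSucc p m
      haveI := W.isScalarTower_algebraOfSpecSucc (K := K) (p := p) (m := m)
      letI := W.residueModuleSucc (K := K) (p := p) hm
      ∀ (π : ∀ v : HeightOneSpectrum (𝓞 K), TamePin v) (cd : ConjugationDatum K)
        (Dd : ∀ k, DualityDatum p cd ((W.eisensteinTower (κ.unitTwist (-1)) hm).ρ k)
          (IwasawaAlgebra.EisensteinCoeff p m (k + 1)))
        (hy : (W.eisensteinDVRSettingLevelsTame (κ.unitTwist (-1)) hm π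
          (placesDividing K (p * N) mul_level_ne_zero)
          (fun _ hv ↦ mem_placesDividing_of_dvd mul_level_ne_zero (dvd_mul_right p N) hv)
          (fun _ hv _ ↦ hasGoodReductionAt_of_not_mem_placesDividing W hN mul_level_ne_zero hv)
          (heegnerKolyvaginPrimes W (κ.unitTwist (-1)) (placesDividing K (p * N) mul_level_ne_zero))
          (W.heegnerKolyvaginPrimes_subset_degreeTwoPrimes_eisensteinTower (κ.unitTwist (-1)) hm (κ.unitTwist (-1))
            (placesDividing K (p * N) mul_level_ne_zero)
            (fun _ hv _ ↦ hasGoodReductionAt_of_not_mem_placesDividing W hN mul_level_ne_zero hv))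
          (fun _ hv ↦ not_mem_of_mem_heegnerKolyvaginPrimes W (κ.unitTwist (-1)) _ hv) jbar cd Dd).SatisfiesH),
        ∃ κKS : (W.eisensteinDVRSettingLevelsTame (κ.unitTwist (-1)) hm π
          (placesDividing K (p * N) mul_level_ne_zero)
          (fun _ hv ↦ mem_placesDividing_of_dvd mul_level_ne_zero (dvd_mul_right p N) hv)
          (fun _ hv _ ↦ hasGoodReductionAt_of_not_mem_placesDividing W hN mul_level_ne_zero hv)
          (heegnerKolyvaginPrimes W (κ.unitTwist (-1)) (placesDividing K (p * N) mul_level_ne_zero))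
          (W.heegnerKolyvaginPrimes_subset_degreeTwoPrimes_eisensteinTower (κ.unitTwist (-1)) hm (κ.unitTwist (-1))
            (placesDividing K (p * N) mul_level_ne_zero)
            (fun _ hv _ ↦ hasGoodReductionAt_of_not_mem_placesDividing W hN mul_level_ne_zero hv))
          (fun _ hv ↦ not_mem_of_mem_heegnerKolyvaginPrimes W (κ.unitTwist (-1)) _ hv) jbar cd Dd).KolyvaginSystem,
          κKS.one ≠ 0 ∧
          ∀ k, κKS.one k = ((κ.unitTwist (-1)).eisensteinH1Limit
              (fun k ↦ (W.baseChange K).torsionGaloisModule ((p : ℤ) ^ k))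
              (fun j ↦ (W.baseChange K).torsionGaloisModuleReduce p j) hm).proj (k + 1)
            (D.toEisensteinH1Linear hm (fun j ↦ (W.baseChange K).torsionGaloisModuleReduce p j) (fun _ _ ↦ rfl)
              ((κ.unitTwist (-1)).eisensteinH1Limit (fun k ↦ (W.baseChange K).torsionGaloisModule ((p : ℤ) ^ k))
                (fun j ↦ (W.baseChange K).torsionGaloisModuleReduce p j) hm)
              hγ hE z) := by
  haveI : NumberField.IsTotallyComplex K := hK.isTotallyComplex
  have himag : ∀ w : NumberField.InfinitePlace K, w.IsComplex := fun w ↦ NumberField.IsTotallyComplex.isComplex w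
  -- the canonical conjugation datum of the SOURCE and its H.4 data
  obtain ⟨c₀, hc₀⟩ := exists_isComplexConjugation (Rat.castHom ℝ)
  obtain ⟨σ, hσ₁, hσ, hτl, hτ₂, -, hτ⟩ := exists_conjugationDatum_ofLifts_τ_eq_absGaloisTransport hK hc₀
  have hπ0 : ∀ v : HeightOneSpectrum (𝓞 K), Nonempty (TamePin v) := nonempty_tamePin
  -- the non-vanishing threshold (NO hypothesis on `𝔖`: `z ≠ 0` alone, g27's
  -- `UniversalToricDescentControlImageNonvanishing.exists_forall_toEisensteinH1Linear_ne_zero_of_ne_zero`)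
  obtain ⟨n₁, hC8⟩ :=
    UniversalToricDescentControlImageNonvanishing.exists_forall_toEisensteinH1Linear_ne_zero_of_ne_zero D hγ hE hz0
  obtain ⟨m₁, hN1⟩ := (W.baseChange K).exists_forall_mem_placesDividing_pow_smul_galoisCohomology_eq_zero
    (κ.unitTwist (-1)) hK (hκ.unitTwist (-1)) hHeeg (mul_level_ne_zero (p := p) (N := N))
  refine ⟨max (m₁ + 1) (p ^ n₁), fun m hm hle π cd Dd hy ↦ ?_⟩
  have hm1 : m₁ < m := Nat.lt_of_lt_of_le (Nat.lt_succ_self _) ((le_max_left _ _).trans hle)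
  have hmn : p ^ n₁ ≤ m := (le_max_right _ _).trans hle
  letI := IwasawaAlgebra.isDomain_quotient_X_pow_add_C p hm
  letI := IwasawaAlgebra.isDiscreteValuationRing_quotient_X_pow_add_C p hm
  haveI := IwasawaAlgebra.EisensteinCoeff.isLocalRing_succ p hm
  letI := IwasawaAlgebra.EisensteinCoeff.algebraOfSpecSucc p m
  haveI := W.isScalarTower_algebraOfSpecSucc (K := K) (p := p) (m := m)
  letI := W.residueModuleSucc (K := K) (p := p) hm
  letI := W.shapiroResidueModule K p
  obtain ⟨κKS, hlink⟩ := W.exists_eisensteinKolyvaginSystem_one_eq_proj_of_source κ hm π hN hγ hE jbar D z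
    (ConjugationDatum.ofLifts σ hσ₁ hσ _ hτl hτ₂) (fun _ ↦ 0)
    (W.shapiroDualityDataUnitTwist _ κ (-1) hκ himag hc₀ hτ)
    (hsrc _ _ _ _) cd Dd
    ((κ.unitTwist (-1)).eisensteinH1Limit (fun k ↦ (W.baseChange K).torsionGaloisModule ((p : ℤ) ^ k))
      (fun j ↦ (W.baseChange K).torsionGaloisModuleReduce p j) hm)
    (fun v hv hpv ↦ hN1 m hm hm1 v hv hpv) hy
  exact ⟨κKS, kolyvaginSystem_one_ne_zero_of_forall_eq_proj _ (hC8 hm _ (fun _ _ ↦ rfl) _ hmn) _ hlink, hlink⟩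


end Link

end WeierstrassCurve

end
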